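import Summits.BirchSwinnertonDyer.Rank1Residual.ManinAdditive.CMClassSevenMembers
import Summits.BirchSwinnertonDyer.Rank1Residual.ManinAdditive.CMClassTwoThreeMembersAny
import Summits.BirchSwinnertonDyer.Rank1Residual.ManinAdditive.CMGammaOneRootLawSplitThree
import Literature.NumberTheory.EllipticCurves.ComplexMultiplicationLFunctionIsogenyHoldsProofs
import HarnessLib

/-!
# C2 and C3 on the WHOLE typed CM locus at once (cell `bsd-f2-manin`, planner `es` g32, MEMO-es §53; FILE A⁸ = this
# file; lands AFTER `…CMClassSevenMembers` (FILE A⁶, T-es-56) and `…CMClassTwoThreeMembersAny` (FILE A⁷, T-es-57);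
# also imports `…CMGammaOneRootLawSplitThree` (E-es-158, p733840) and the tree theorem
# `LFunction_eq_of_isIsogenous_holds` (Knapp Thm. 11.67, `ComplexMultiplicationLFunctionIsogenyHoldsProofs`))

TYPER NOTE (typer g21, T-es-58).  SOURCE = HOME/es/g32/CMLocus-es-g32.lean sha16 3e27c49b1c0e8e5c (161 l.; es: combined scratch
CMLocus-scratch2.lean b665df4796cc0a22 farm rc 0 · 0 · 0 · 0; typer: COMBINED SIM HOME/typer/g21/Combined_T58_sim.lean (A⁵ + A⁶ + A⁷ inlined
under this text) rc 0 · 0 warnings — the check farm was still `stale:…:unbuilt` on the minutes-old A⁵/A⁶/A⁷ oleans) VERBATIM except this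
note.  FILE A⁸ of es's CM series, ns `…ManinAdditive.KatoCurve.CMTwinMinimal` §13; lands AFTER A⁶ `…CMClassSevenMembers` (T-es-56) and A⁷
`…CMClassTwoThreeMembersAny` (T-es-57, p735697) and imports them + `…CMGammaOneRootLawSplitThree` (p733840) +
`Literature…ComplexMultiplicationLFunctionIsogenyHoldsProofs` (tree theorem `LFunction_eq_of_isIsogenous_holds`, Knapp Thm 11.67, discharges
`hL`) + HarnessLib — route-independent.  CONTENT (es MEMO-es §53): ONE plain def **`IsOnCMLocus W`** (the TYPED CM-locus witness: j(W) one of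
the six rigid CM invariants, or a globally minimal V ~ W with c₆(V) = 0 / c₄(V) = 0 / j(V) = −3375; es is explicit that «IsOnCMLocus W ⟺ W has
CM» is the classical 13-j classification and is NOT typed here) + 6 PROVED theorems: THEOREM 53₂ `rootLawAtTwo_on_cmLocus` (4 ∣ N; hypotheses
= the five law nodes at 2 E-es-152₂/155/159/154/160 + SHAPE₂⁺/₃⁺/₇⁺), THEOREM 53₃ `rootLawAtThree_on_cmLocus` (9 ∣ N; nodes E-es-152₃/156/157/158
+ SHAPEs), COR 53.S₂/S₃ `not_two/three_dvd_maninConstant₁_on_cmLocus` (Stevens p ∤ c₁), COR 53.R₂/R₃ `not_two/three_dvd_maninConstant_on_cmLocus`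
(the matrices of C2 `ManinOddAtFour` / C3 `ManinPrimeToThreeAtNine` on the locus for lattice-optimal X₀-data with a second traceless prime) =
es's ONE by-name entry point per crux for the CM locus (L-es-g32-7 to LEAD p1 / p2 g18).  No new conjecture node; all nine law nodes stay
`@[conjecture]` in the kernel (THEOREM 45/47/48 on paper, REF1 §R163/§R177/§R180/§R181 SOUND).  es asked for `--supports stmt-BirchSwinnertonDyer-22967`;
refused by the gate for `…/ManinAdditive/` targets (gotcha 108) — bears_on carried here: stmt-BirchSwinnertonDyer-22967 (C2),
stmt-BirchSwinnertonDyer-22968 (C3).  REFUTER: ref1 R-es-78 (§53.2 classification claims + by-name probe of A⁷/A⁸) PENDING at landing.  Typer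
checks: 7 decl names fresh tree-wide; no `[cite:]` keys; no instances, no notation; `--kind statement` (one def).  PARTITION 0 · beyond-print
theorem: no · C2/C3 off the CM locus, Manin `c = 1` and BSD are NOT proved by this; C2/C3 OPEN.

One predicate, two laws, four corollaries.  `IsOnCMLocus W` := `j(W)` is one of the six RIGID CM invariants (`8000,
−32768, −884736, −884736000, −147197952000, −262537412640768000`: the maximal orders of `ℚ(√−2), ℚ(√−11), ℚ(√−19),
ℚ(√−43), ℚ(√−67), ℚ(√−163)`) OR the class of `W` contains a globally minimal `V ~ W` with `c₆(V) = 0` (`ℚ(i)`),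
`c₄(V) = 0` (`ℚ(√−3)`) or `j(V) = −3375` (`ℚ(√−7)`).  THEOREM 53₂/53₃: the root `Γ₁(N)`-law at `2` (`4 ∣ N`) resp. `3`
(`9 ∣ N`) holds for EVERY globally minimal `W` with `IsOnCMLocus W`, from the nine law nodes E-es-152₂/152₃/154/155/
156/157/158/159/160 (all `@[conjecture]` in the kernel; THEOREM 45/48 on paper, audited SOUND REF1 §R163/§R177/§R180/
§R181) and the three classification facts SHAPE₂⁺/₃⁺/₇⁺ (`CMClassMembersTwo/Three/Seven`); `hL` is discharged by the
tree.  COR 53.S₂/S₃: Stevens' `p ∤ c₁` on the locus; COR 53.R₂/R₃: the matrices of C2 `ManinOddAtFour` / C3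
`ManinPrimeToThreeAtNine` on the locus for `X₀(N)`-data with a second traceless prime.
HONEST FRAMING: `IsOnCMLocus W ⟺ W has CM` is the classical classification (13 rational CM `j`; the four non-maximal
orders are Vélu quotients of maximal-order members of the same class) and is NOT typed here; C2/C3 off the CM locus,
Manin's conjecture and BSD are NOT proved by this.  PARTITION 0 · beyond-print theorem: no · bears_on
stmt-BirchSwinnertonDyer-22967 (C2), stmt-BirchSwinnertonDyer-22968 (C3).
-/

set_option autoImplicit false

noncomputable section

namespace Summit.BirchSwinnertonDyer.Rank1Residual.ManinAdditive.KatoCurve.CMTwinMinimal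

open Complex Polynomial WeierstrassCurve Literature.NumberTheory.EllipticCurves
  Literature.NumberTheory.EllipticCurves.ModularForms
  Summit.BirchSwinnertonDyer.Rank1Residual.ManinAdditive.KatoCurve.CMOptimal
  Summit.BirchSwinnertonDyer.Rank1Residual.ManinAdditive.KatoCurve.CMOptimal.TwinLattice

/-! ## §13 The whole CM locus at once: C2 and C3 on `IsOnCMLocus` (MEMO-es §53)

`IsOnCMLocus W` is the TYPED CM-locus witness: either `j(W)` is one of the six "rigid" CM invariants (the maximal orders
of `ℚ(√−2), ℚ(√−11), ℚ(√−19), ℚ(√−43), ℚ(√−67), ℚ(√−163)`, whose classes over `ℚ` consist of curves with that same `j`),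
or the class of `W` contains a globally minimal `V ~ W` with `c₆(V) = 0` (`j = 1728`, `ℚ(i)`), `c₄(V) = 0` (`j = 0`,
`ℚ(√−3)`) or `j(V) = −3375` (`ℚ(√−7)`).  By the classical classification (13 rational CM `j`-invariants; the four
non-maximal orders `ℤ[2i], ℤ[√−3], ℤ[3ω], ℤ[√−7]` are Vélu quotients of maximal-order curves of the same class)
`IsOnCMLocus W ⟺ W has CM` for elliptic `W/ℚ` — that equivalence is NOT typed here; the theorems below cover exactly
the typed predicate.  `hL` («Faltings», in fact Knapp Thm. 11.67) is discharged by the tree theorem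
`LFunction_eq_of_isIsogenous_holds`. -/

section CMLocus

open CongruenceSubgroup
open scoped MatrixGroups ModularForm

variable {N : ℕ} [NeZero N]

/-- **The typed CM locus**: `j(W)` rigid (six maximal orders with a single rational `j` per class) or a maximal-order
root `V ~ W` of `ℚ(i)` (`c₆(V) = 0`), `ℚ(√−3)` (`c₄(V) = 0`) or `ℚ(√−7)` (`j(V) = −3375`) in the class. -/
def IsOnCMLocus (W : WeierstrassCurve ℚ) [W.IsElliptic] : Prop :=
  (W.j = 8000 ∨ W.j = -32768 ∨ W.j = -884736 ∨ W.j = -884736000 ∨ W.j = -147197952000 ∨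
      W.j = -262537412640768000) ∨
    ∃ (V : WeierstrassCurve ℚ) (_ : V.IsElliptic) (_ : V.IsGloballyMinimal),
      WeierstrassCurve.IsIsogenous V W ∧ (V.c₆ = 0 ∨ V.c₄ = 0 ∨ V.j = -3375)

/-- **THEOREM 53₂ — the root `Γ₁(N)`-law at `2` on the whole typed CM locus with `4 ∣ N`**, from the five law nodes at
`2` (E-es-152₂, 155, 159, 154, 160), the three classification facts SHAPE₂⁺/₃⁺/₇⁺ and Knapp's theorem (tree):
for every globally minimal `W` on the CM locus, every newform `f` of `W` and Néron lattice `LW`, `Λ₁(f) ⊆ LW ⊗ ℤ₍₂₎`. -/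
theorem rootLawAtTwo_on_cmLocus
    (h152 : CMGammaOneRootLawTwoLocal) (h155 : CMGammaOneRootLawTwoLocalJ0) (h159 : CMGammaOneRootLawTwoLocalJSqrt7)
    (h154 : CMGammaOneRootLawTwoLocalJ8000) (h160 : CMGammaOneRootLawTwoLocalJInertTwo)
    (hcl₂ : CMClassMembersTwo) (hcl₃ : CMClassMembersThree) (hcl₇ : CMClassMembersSeven)
    (W : WeierstrassCurve ℚ) [W.IsElliptic] [W.IsGloballyMinimal] (f : CuspForm (Gamma0 N) 2) (LW : PeriodPair)
    (hfW : IsNewformOf W f) (hLW : IsNeronLatticeOf (W.baseChange ℂ) LW) (hW : IsOnCMLocus W) (hN : 2 ^ 2 ∣ N) :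
    ∀ z ∈ periodLatticeGamma1 f, ∃ s : ℤ, ¬ (2 : ℤ) ∣ s ∧ (s : ℂ) * z ∈ LW.lattice := by
  rcases hW with hj | ⟨V, hE, hmin, hiso, hV⟩
  · rcases hj with hj | hj
    · exact h154 W f LW hj hfW hLW
    · exact h160 W f LW hj hN hfW hLW
  · haveI := hE
    haveI := hmin
    rcases hV with h6 | h4 | h7
    · exact rootLawAtTwo_on_cmClass_two h152 hcl₂ LFunction_eq_of_isIsogenous_holds W f LW hfW hLW V h6 hiso
    · exact rootLawAtTwo_on_cmClass_three h155 hcl₃ LFunction_eq_of_isIsogenous_holds W f LW hfW hLW V h4 hiso hN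
    · exact rootLawAtTwo_on_cmClass_seven_of_classMembers h159 hcl₇ LFunction_eq_of_isIsogenous_holds W f LW hfW
        hLW V h7 hiso hN

/-- **THEOREM 53₃ — the root `Γ₁(N)`-law at `3` on the whole typed CM locus with `9 ∣ N`**, from the four law nodes at
`3` (E-es-152₃, 156, 157, 158), SHAPE₂⁺/₃⁺/₇⁺ and Knapp's theorem: `Λ₁(f) ⊆ LW ⊗ ℤ₍₃₎`. -/
theorem rootLawAtThree_on_cmLocus
    (h152 : CMGammaOneRootLawThreeLocal) (h156 : CMGammaOneRootLawThreeLocalJ1728)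
    (h157 : CMGammaOneRootLawThreeLocalJInert) (h158 : CMGammaOneRootLawThreeLocalJSplit)
    (hcl₂ : CMClassMembersTwo) (hcl₃ : CMClassMembersThree) (hcl₇ : CMClassMembersSeven)
    (W : WeierstrassCurve ℚ) [W.IsElliptic] [W.IsGloballyMinimal] (f : CuspForm (Gamma0 N) 2) (LW : PeriodPair)
    (hfW : IsNewformOf W f) (hLW : IsNeronLatticeOf (W.baseChange ℂ) LW) (hW : IsOnCMLocus W) (hN : 3 ^ 2 ∣ N) :
    ∀ z ∈ periodLatticeGamma1 f, ∃ s : ℤ, ¬ (3 : ℤ) ∣ s ∧ (s : ℂ) * z ∈ LW.lattice := by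
  rcases hW with hj | ⟨V, hE, hmin, hiso, hV⟩
  · rcases hj with hj | hj | hj
    · exact h158 W f LW (Or.inl hj) hN hfW hLW
    · exact h158 W f LW (Or.inr hj) hN hfW hLW
    · exact h157 W f LW (Or.inr hj) hN hfW hLW
  · haveI := hE
    haveI := hmin
    rcases hV with h6 | h4 | h7
    · exact rootLawAtThree_on_cmClass_two h156 hcl₂ LFunction_eq_of_isIsogenous_holds W f LW hfW hLW V h6 hiso hN
    · exact rootLawAtThree_on_cmClass_three h152 hcl₃ LFunction_eq_of_isIsogenous_holds W f LW hfW hLW V h4 hiso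
    · exact rootLawAtThree_on_cmClass_seven_of_classMembers h157 hcl₇ LFunction_eq_of_isIsogenous_holds W f LW hfW
        hLW V h7 hiso hN

/-- **COR 53.S₂ — Stevens' `2 ∤ c₁` on the whole typed CM locus with `4 ∣ N`** (whichever member is `X₁(N)`-optimal). -/
theorem not_two_dvd_maninConstant₁_on_cmLocus
    (h152 : CMGammaOneRootLawTwoLocal) (h155 : CMGammaOneRootLawTwoLocalJ0) (h159 : CMGammaOneRootLawTwoLocalJSqrt7)
    (h154 : CMGammaOneRootLawTwoLocalJ8000) (h160 : CMGammaOneRootLawTwoLocalJInertTwo)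
    (hcl₂ : CMClassMembersTwo) (hcl₃ : CMClassMembersThree) (hcl₇ : CMClassMembersSeven)
    (W : WeierstrassCurve ℚ) [W.IsElliptic] [W.IsGloballyMinimal] (D : Gamma1ParametrizationData W N)
    (hopt : D.IsOptimal) (hW : IsOnCMLocus W) (hN : 2 ^ 2 ∣ N) : ¬ (2 : ℤ) ∣ D.maninConstant :=
  not_dvd_maninConstant₁_of_rootLaw_of_witness D hopt
    (rootLawAtTwo_on_cmLocus h152 h155 h159 h154 h160 hcl₂ hcl₃ hcl₇ W D.f D.L D.isNewformOf D.isNeronLattice hW hN)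
    (exists_primitive_witness D.L 2)

/-- **COR 53.S₃ — Stevens' `3 ∤ c₁` on the whole typed CM locus with `9 ∣ N`.** -/
theorem not_three_dvd_maninConstant₁_on_cmLocus
    (h152 : CMGammaOneRootLawThreeLocal) (h156 : CMGammaOneRootLawThreeLocalJ1728)
    (h157 : CMGammaOneRootLawThreeLocalJInert) (h158 : CMGammaOneRootLawThreeLocalJSplit)
    (hcl₂ : CMClassMembersTwo) (hcl₃ : CMClassMembersThree) (hcl₇ : CMClassMembersSeven)
    (W : WeierstrassCurve ℚ) [W.IsElliptic] [W.IsGloballyMinimal] (D : Gamma1ParametrizationData W N)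
    (hopt : D.IsOptimal) (hW : IsOnCMLocus W) (hN : 3 ^ 2 ∣ N) : ¬ (3 : ℤ) ∣ D.maninConstant :=
  not_dvd_maninConstant₁_of_rootLaw_of_witness D hopt
    (rootLawAtThree_on_cmLocus h152 h156 h157 h158 hcl₂ hcl₃ hcl₇ W D.f D.L D.isNewformOf D.isNeronLattice hW hN)
    (exists_primitive_witness D.L 3)

/-- **COR 53.R₂ — C2 (`ManinOddAtFour`'s matrix) on the whole typed CM locus**, for `X₀(N)`-data with the lattice clause
and a second traceless prime `q ≠ 2`, `q² ∣ N` (it exists iff `N` is not a power of `2`: a CM curve is additive at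
every bad prime, so every `q ∣ N` has `q² ∣ N`): `2 ∤ c₀`.  Conditional on the five law nodes at `2` and SHAPE₂⁺/₃⁺/₇⁺ only. -/
theorem not_two_dvd_maninConstant_on_cmLocus
    (h152 : CMGammaOneRootLawTwoLocal) (h155 : CMGammaOneRootLawTwoLocalJ0) (h159 : CMGammaOneRootLawTwoLocalJSqrt7)
    (h154 : CMGammaOneRootLawTwoLocalJ8000) (h160 : CMGammaOneRootLawTwoLocalJInertTwo)
    (hcl₂ : CMClassMembersTwo) (hcl₃ : CMClassMembersThree) (hcl₇ : CMClassMembersSeven)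
    (W : WeierstrassCurve ℚ) [W.IsElliptic] [W.IsGloballyMinimal] (D : ModularParametrizationData W N)
    (hD : ∀ z ∈ D.L.lattice, ∃ w ∈ periodLattice D.f, z = D.c * w) (hW : IsOnCMLocus W)
    {q : ℕ} (hq : q.Prime) (hq2 : q ≠ 2) (hN : 2 ^ 2 ∣ N) (hqN : q ^ 2 ∣ N) : ¬ (2 : ℤ) ∣ D.maninConstant :=
  not_dvd_maninConstant_of_classLaw_of_twoTracelessPrimes W D hD Nat.prime_two hq hq2 hN hqN
    (rootLawAtTwo_on_cmLocus h152 h155 h159 h154 h160 hcl₂ hcl₃ hcl₇ W D.f D.L D.isNewformOf D.isNeronLattice hW hN)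

/-- **COR 53.R₃ — C3 (`ManinPrimeToThreeAtNine`'s matrix) on the whole typed CM locus**, for `X₀(N)`-data with the
lattice clause and a second traceless prime `q ≠ 3`, `q² ∣ N` (it exists iff `N` is not a power of `3`; e.g. not for
the `ℚ(√−3)`-classes of conductor `27` or `243`): `3 ∤ c₀`.  Conditional on the four law nodes at `3` and SHAPE₂⁺/₃⁺/₇⁺ only. -/
theorem not_three_dvd_maninConstant_on_cmLocus
    (h152 : CMGammaOneRootLawThreeLocal) (h156 : CMGammaOneRootLawThreeLocalJ1728)
    (h157 : CMGammaOneRootLawThreeLocalJInert) (h158 : CMGammaOneRootLawThreeLocalJSplit)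
    (hcl₂ : CMClassMembersTwo) (hcl₃ : CMClassMembersThree) (hcl₇ : CMClassMembersSeven)
    (W : WeierstrassCurve ℚ) [W.IsElliptic] [W.IsGloballyMinimal] (D : ModularParametrizationData W N)
    (hD : ∀ z ∈ D.L.lattice, ∃ w ∈ periodLattice D.f, z = D.c * w) (hW : IsOnCMLocus W)
    {q : ℕ} (hq : q.Prime) (hq3 : q ≠ 3) (hN : 3 ^ 2 ∣ N) (hqN : q ^ 2 ∣ N) : ¬ (3 : ℤ) ∣ D.maninConstant :=
  not_dvd_maninConstant_of_classLaw_of_twoTracelessPrimes W D hD Nat.prime_three hq hq3 hN hqN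
    (rootLawAtThree_on_cmLocus h152 h156 h157 h158 hcl₂ hcl₃ hcl₇ W D.f D.L D.isNewformOf D.isNeronLattice hW hN)

end CMLocus

end Summit.BirchSwinnertonDyer.Rank1Residual.ManinAdditive.KatoCurve.CMTwinMinimal

end
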